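import Summits.QuantumFields.BalabanUV.T4Continuum.Support.ShellMeasureAverageProp5Levels

/-!
# [B7] PROPOSITION 5 AT A GENERAL REGULAR BACKGROUND, k-UNIFORM — the assembly: (147), (157), (156) per bond for B7's own
# composites `linCovIter` ∕ `logCovIter`, the one-step binders DISCHARGED BY NAME from rows S68 (a), S68 (b), S55, S56
# (`ShellMeasureAverageProp5General`)

Audit cell `pub-balaban`, sub-cell `t4`, NE7c ROUND-2 crew seat `b2b-balaban-t4-ne7c-formalise-leaf-10` gen 10; owner table
`t4/b2b-balaban-t4-ne7c-p1/LEAVES-NE7c-P1.md` row **S68 (c)** «[B7] Prop. 5 at a general regular background — the k-fold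
composition» (cut l.15650 accepted by the owner l.15880; (a) = leaf-05-g7, (b) = leaf-04-g5, (c) = this seat).  INPUTS BY NAME
(none restated): this seat's Literature reproductions `B7Prop5GeneralOperators` ∕ `…OperatorFacts` ((139)–(142) operators and
facts on kernel columns), `B7Prop5GeneralLinear` ((143)–(147) per bond over the majorant (139) as hypothesis),
`B7Prop5GeneralInduction` ((149)–(157) per bond over (139), (148), locality as hypotheses); row S68 (a) = leaf-05-g7's
`ShellMeasureAverageMajorantPdev.norm_linQcov_le_majorant_of_pdev` ((139) in majorant form at a general background, b07-g4's
`B7BlockGeometry.Qav ∕ Qdd`); row S68 (b) = leaf-04-g5's `ShellMeasureAverageLocality148.{Ccov_congr, ineq148_general,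
differentiableOn_Ccov_insCfg}` ((148) + locality of (89)∕(122)); row S55 (`B7Prop3GeneralTild.linQcov_add ∕ _smul`,
`ShellMeasureAverageProp3Discharge.loopReg_of_pdev`); row S56 (`B7Prop4GeneralLevels.level_regularity`,
`ShellMeasureAverageProp4General.prop4_general_bounds`, `C1cov`, `O1cov`, `two_mul_le_betaMax`); row S64
(`ShellMeasureLandauCorrectionB7.scaleIns`, `landauCf`).

THE PRINTED STATEMENT ([Balaban1985Averaging] p. 42, Proposition 5): «The functional derivative of Q_k(U₀, ηA) is a bounded
function for α₀, α₁ sufficiently small, and we have the bounds |(δ∕δA_b)Q_k(U₀, ηA, c)| ≦ 1 + 2C′₁α₀ + C₃|A| < 1 + 2C′₁α₀ + C₃α₁,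
(156) |(δ∕δA_b)C_k(U₀, A, c)| ≦ C₃|A| < C₃α₁. (157)» with (147) «|Q_k(U₀; c, b)| ≦ 1 + 2C′₁α₀» for the linear part.

WHAT THIS FILE PROVES (kernel, 0 sorry), for `L ≥ 2`, a structure group `G` (`AvgClosed d L G`), a background `U₀` `G`-valued with
«(52)» `pdev U₀ < α₀L^{−2k}`, `C₀α₀ ≤ 1∕3`, `4α₀ ≤ c₂′(d,L)`:
* §1 the BRIDGES between b07-g4's operators and this seat's: `(L:ℝ)·Qav L g (z,κ) = avQ L g (Lz) κ` (IDENTITY) and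
  `Qdd L g (z,κ) ≤ ddQ L g (Lz) κ` (`qppBonds ⊆ S1`: same box `B(c₋) ∪ B(c₊)`);
* §2 the per-level DISCHARGES at the backgrounds `Ū₀ʲ = avgIter L U₀ j`, `j ≤ k` (`level_data`): additivity∕homogeneity of the
  one-step linear part (`hadd_levels`, `hsmul_levels`), the majorant (139) with `θ = thetaCov d L α₀ = 3200(d+1)(d+4)L^{d+1}α₀`
  (`h139_levels` ← S68 (a)), locality of `C(Ū₀ʲ, ·)(c)` (`hloc_levels` ← S68 (b)), (148) with `ρ = c₃∕4`, `C″ = C1ppCov d L =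
  4·C1cov·L^{d+2}` and differentiability (`h148_levels`, `hdiff_levels` ← S68 (b));
* §3 **PROPOSITION 5 AT A GENERAL BACKGROUND, k-UNIFORM, PER BOND** in `B`-variables: `prop5_general_147` (the composed linear
  part: `‖LʲηQ_j(U₀)(Xδ_b)(c)‖ ≤ (1 + θ(Lʲη)²)·Lʲ·L^{−jd}·‖X‖`, zero unless `b ⊂ Bʲ(c₋) ∪ Bʲ(c₊)`), **`prop5_general_157`**
  (`‖dC_j(B; Xδ_b)(c)‖ ≤ C3cov·(Lʲ)²·L^{−jd}·b·‖X‖`, `C3cov d L = 16·C1ppCov d L`, locality), `prop5_general_156` — under the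
  displayed smallness `h145` («16dC′₁L^{−4}α₀ ≦ 1») and `h155` (print's (155) in the per-bond bookkeeping), BOTH INDEPENDENT OF
  `k` once the field size enters as `Lᵏb = |A|`;
* §4 **(P5-d) THE PER-BOND FACE FOR ROW S64's `landauCf`** (END-II's Landau correction in the `A`-currency): for `b ∈ S`,
  `c ∈ S′`, `‖∂∕∂A_b landauCf(A)(c)·X‖ ≤ C3cov d L·‖A‖·L^{−kd}·‖X‖` as a `HasLineDerivAt` in the direction `Pi.single b X`
  (`hasLineDerivAt_landauCf_single`) — leaf-08-g12's (72)-TYPE input «[4] Prop. 5: bounded local derivative of the averaging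
  map's nonlinear part», k-UNIFORM; the locality half `= 0 unless b ⊂ Bᵏ(c₋) ∪ Bᵏ(c₊)` is leaf-04-g5's
  `fderiv_landauCf_apply_single_eq_zero`; v1.1 (additive): `norm_fderiv_landauCf_le_Qpp` — (157) in the PAIRING form (138)∕(149) for a general
  variation `δA ∈ 𝔸^S`: `‖D(landauCf)(A)(δA)(c)‖ ≤ C3cov·‖A‖·(Q″_k|δA|)(c)` (sum of the per-bond columns by linearity).
HONEST (cell): B7-level bookkeeping on OUR side of WALL §2 (a) (W-a (Cf′)); constants explicit but not optimised (print: «C₃ > C″₁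
and α₀, α₁ sufficiently small»); the `η^d`-weighted pairing (138) is rendered per bond as in b07's `B7Prop5Flat` (DIVERGENCE
D-b07g18.1); Prop. 7 (complex background) untouched; nothing of Bałaban's live-level estimates discharged; NOTHING in the
countdown moves; «NE7c ⇐ the named binders»; NE7c NOT PRINTED, NOT PROVED; spine PROVED 0∕9; rung (B)+1 on a FINITE T⁴ — NOT
infinite volume, NOT mass gap, NOT Clay.  HONEST DEPENDENCY: continuum YM on T⁴ ⇐ BetaPertH ∧ nine spine estimates (0/9
proved); BetaPertH ⇐ (D1) ∧ (D4) ∧ CAP+tail; G-an2-4 gates asym, D1 and NE2/3/4.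
-/

noncomputable section

open scoped BigOperators
open NormedSpace Finset Metric

namespace Summit.QuantumFields.BalabanUV.T4Continuum.ShellMeasureAverageProp5General

open Literature.MathematicalPhysics.QuantumFieldTheory.Balaban1983to89
open Literature.MathematicalPhysics.QuantumLattice (ZdEdge blockBase blockSites)
open B7Prop1Explicit B7Prop1Local B7Prop2Explicit B7Prop3Flat B7Prop4Flat B7Eq92Concrete B7Prop3GeneralLinear
  B7Prop4GeneralLevels B7Ineq148 B7Prop5GeneralOperators B7Prop5GeneralOperatorFacts B7Prop5GeneralLinear
  B7Prop5GeneralInduction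
open B7Prop5Flat (BondIn S1 bump bondsIn mem_bondsIn restr bump_eq_zero_of)
open B7BlockGeometry (Qav Qdd qppBonds twoBlocks mem_qppBonds Qdd_apply')
open B7Prop3GeneralTild (linQcov_add linQcov_smul)
open Summit.QuantumFields.BalabanUV.T4Continuum.ShellMeasureAverageProp3Discharge (loopReg_of_pdev)
open Summit.QuantumFields.BalabanUV.T4Continuum.ShellMeasureAverageProp4General
open Summit.QuantumFields.BalabanUV.T4Continuum.ShellMeasureAverageMajorantPdev
open Summit.QuantumFields.BalabanUV.T4Continuum.ShellMeasureAverageLocality148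
open Summit.QuantumFields.BalabanUV.T4Continuum.ShellMeasureLandauCorrectionB7
open Summit.QuantumFields.BalabanUV.T4Continuum.ShellMeasureAverageProp5Levels

export B7Prop1Explicit (Site)

variable {d : ℕ} {𝔸 : Type*} [NormedRing 𝔸] [NormedAlgebra ℂ 𝔸] [CompleteSpace 𝔸] [NormOneClass 𝔸]

/-! ## §3 Proposition 5 at a general background, per bond, k-uniform (`B`-variables) -/

section Regime

variable (L : ℕ) (hL : 2 ≤ L) {G : Subgroup 𝔸ˣ} (hG : AvgClosed d L G) (k : ℕ)
  (U₀ : Site d → Fin d → 𝔸ˣ) (hU₀ : ∀ x κ, U₀ x κ ∈ G) {α₀ : ℝ} (hα : 0 < α₀)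
  (hα3 : C0 d * α₀ ≤ 1 / 3) (hα4 : 4 * α₀ ≤ c2' d L) (h52 : pdev U₀ < α₀ * (((L : ℝ) ^ k)⁻¹) ^ 2)

variable (B : Site d → Fin d → 𝔸) {b : ℝ} (hb : 0 ≤ b) (hB : ∀ x κ, ‖B x κ‖ ≤ b)
  (hsmall : Real.exp (4 * O1cov d * α₀) * (1 + 8 * C1cov d * ((L : ℝ) ^ k * b)) ≤ 2)
  (hc₃ : 8 * ((L : ℝ) ^ k * b) < c3 d L)
  (h145 : 8 * d * thetaCov d L α₀ * (L : ℝ)⁻¹ ^ 4 ≤ 1)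
  (h155 : (2 * (L : ℝ) - 1) * (L : ℝ)⁻¹ ^ 2 + 2 * d * thetaCov d L α₀ * (L : ℝ)⁻¹ ^ 3
    + 1 / 8 * (1 + 2 * d * thetaCov d L α₀ * (L : ℝ)⁻¹ ^ 2 + 2 * d * C3cov d L * ((L : ℝ) ^ k * b)) * (L : ℝ)⁻¹ ^ 2 ≤ 1)

include hL hG hU₀ hα hα3 hα4 h52 in
/-- **(147) AT A GENERAL BACKGROUND, PER BOND, k-UNIFORM** «|Q_k(U₀; c, b)| ≦ 1 + 2C′₁α₀»: for every `j ≤ k`, every unit-lattice bond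
`b = ⟨y, y + e_μ⟩`, `X ∈ 𝔸` and every bond `c = ⟨z, z + e_κ⟩` of the `j`-th lattice, `‖LʲηQ_j(U₀)(Xδ_b)(c)‖ ≤ (1 + θ(Lʲ∕Lᵏ)²)·Lʲ·L^{−jd}·‖X‖`
(`θ = thetaCov d L α₀`; under «16dC′₁L^{−4}α₀ ≦ 1» = `h145`), and it VANISHES unless `b ⊂ Bʲ(c₋) ∪ Bʲ(c₊)`.
[cite: Balaban1985Averaging, (146)–(147) p.40] -/
theorem prop5_general_147 (h145 : 8 * d * thetaCov d L α₀ * (L : ℝ)⁻¹ ^ 4 ≤ 1) (y : Site d) (μ : Fin d) (X : 𝔸)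
    {j : ℕ} (hj : j ≤ k) (z : Site d) (κ : Fin d) :
    ‖linCovIter L U₀ (bump y μ X) j z κ‖ ≤
        (1 + thetaCov d L α₀ * ((L : ℝ) ^ j * ((L : ℝ) ^ k)⁻¹) ^ 2) * ((L : ℝ) ^ j * (((L : ℝ) ^ j) ^ d)⁻¹) * ‖X‖ ∧
      (¬ BondIn (loK L j z) (bondHiK L j z κ) y μ → linCovIter L U₀ (bump y μ X) j z κ = 0) :=
  ⟨ineq147 L hL U₀ k (thetaCov_nonneg d L hα.le) (h139_levels L hL hG k U₀ hU₀ hα hα3 hα4 h52) h145 y μ X hj z κ,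
    linCovIter_bump_eq_zero L hL U₀ k (thetaCov_nonneg d L hα.le) (h139_levels L hL hG k U₀ hU₀ hα hα3 hα4 h52) h145 y μ X
      hj z κ⟩

include hL hG hU₀ hα hα3 hα4 h52 hb hB hsmall hc₃ h145 h155 in
/-- **PROPOSITION 5 (157) AT A GENERAL BACKGROUND, PER BOND, k-UNIFORM** «|(δ∕δA_b)C_k(U₀, A, c)| ≦ C₃|A|»: for every `j ≤ k`, every
unit-lattice bond `b = ⟨y, y + e_μ⟩`, `X ∈ 𝔸` and every bond `c` of the `j`-th lattice, `B′ ↦ C_j(B′)(c)` (`logCovIter − linCovIter`)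
is differentiable at `B` in the direction `X·δ_b` ((137), `t ∈ ℂ`) with `‖dC_j(B; Xδ_b)(c)‖ ≤ C3cov·(Lʲ)²·L^{−jd}·b·‖X‖` (at `j = k`,
`B = ηA`: `C₃|A|·η^d·‖X‖`), and the derivative VANISHES unless `b ⊂ Bʲ(c₋) ∪ Bʲ(c₊)` — the one-step binders of
`B7Prop5GeneralInduction.prop5_157` discharged by `hadd∕hsmul∕h139∕hloc∕h148∕hdiff_levels` and row S56's (131).
[cite: Balaban1985Averaging, Prop. 5 (157) p.42, (149)–(155) pp.40–41] -/
theorem prop5_general_157 (y : Site d) (μ : Fin d) (X : 𝔸) {j : ℕ} (hj : j ≤ k) (z : Site d) (κ : Fin d) :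
    HasLineDerivAt ℂ (fun B' => CCovIter L U₀ B' j z κ) (dCov L U₀ B (bump y μ X) j z κ) B (bump y μ X) ∧
      ‖dCov L U₀ B (bump y μ X) j z κ‖ ≤ C3cov d L * ((L : ℝ) ^ j) ^ 2 * (((L : ℝ) ^ j) ^ d)⁻¹ * b * ‖X‖ ∧
      (¬ BondIn (loK L j z) (bondHiK L j z κ) y μ → dCov L U₀ B (bump y μ X) j z κ = 0) := by
  have hL1 : 1 ≤ L := le_trans (by norm_num) hL
  have hL1r : (1 : ℝ) ≤ L := by exact_mod_cast hL1
  have hc₃' : 2 * ((L : ℝ) ^ k * b) ≤ c3 d L := by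
    have : 0 ≤ (L : ℝ) ^ k * b := by positivity
    linarith
  have h131 : ∀ j < k, ∀ (x : Site d) (κ : Fin d), ‖logCovIter L U₀ B j x κ‖ ≤ 2 * ((L : ℝ) ^ j * b) :=
    fun j hj => (prop4_general_bounds L hL hG k U₀ hU₀ hα hα3 hα4 h52 B hb hB hsmall hc₃' j hj.le).2
  have hρ : ∀ j < k, 2 * ((L : ℝ) ^ j * b) < c3 d L / 4 := by
    intro j hj
    have hjk : (L : ℝ) ^ j * b ≤ (L : ℝ) ^ k * b := mul_le_mul_of_nonneg_right (pow_le_pow_right₀ hL1r hj.le) hb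
    linarith
  have hquot : 2 * C1ppCov d L / C3cov d L = 1 / 8 := by
    have := C1ppCov_pos d hL1
    rw [C3cov]; field_simp; ring
  have h155' : (2 * (L : ℝ) - 1) * (L : ℝ)⁻¹ ^ 2 + 2 * d * thetaCov d L α₀ * (L : ℝ)⁻¹ ^ 3
      + 2 * C1ppCov d L / C3cov d L
        * (1 + 2 * d * thetaCov d L α₀ * (L : ℝ)⁻¹ ^ 2 + 2 * d * C3cov d L * ((L : ℝ) ^ k * b)) * (L : ℝ)⁻¹ ^ 2 ≤ 1 := by
    rw [hquot]; exact h155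
  exact prop5_157 L hL U₀ k (thetaCov_nonneg d L hα.le) (C1ppCov_pos d hL1).le (C3cov_pos d hL1) hb
    (hadd_levels L hL hG k U₀ hU₀ hα hα3 hα4 h52) (hsmul_levels L hL hG k U₀ hU₀ hα hα3 hα4 h52)
    (h139_levels L hL hG k U₀ hU₀ hα hα3 hα4 h52) h145 (hloc_levels L hL k U₀)
    (h148_levels L hL hG k U₀ hU₀ hα hα3 hα4 h52) (hdiff_levels L hL hG k U₀ hU₀ hα hα3 hα4 h52) B h131 hρ h155' y μ X hj
    z κ

include hL hG hU₀ hα hα3 hα4 h52 hb hB hsmall hc₃ h145 h155 in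
/-- **PROPOSITION 5 (156) AT A GENERAL BACKGROUND, PER BOND, k-UNIFORM** «|(δ∕δA_b)Q_k(U₀, ηA, c)| ≦ 1 + 2C′₁α₀ + C₃|A|»: the composite
`B′ ↦ Q_j(U₀, ηB′)(c)` (`logCovIter`) is differentiable at `B` in the direction `X·δ_b` with derivative of norm
`≤ ((1 + θ(Lʲ∕Lᵏ)²)·Lʲ + C3cov·(Lʲ)²·b)·L^{−jd}·‖X‖`. [cite: Balaban1985Averaging, Prop. 5 (156) p.42] -/
theorem prop5_general_156 (y : Site d) (μ : Fin d) (X : 𝔸) {j : ℕ} (hj : j ≤ k) (z : Site d) (κ : Fin d) :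
    HasLineDerivAt ℂ (fun B' => logCovIter L U₀ B' j z κ)
        (dCov L U₀ B (bump y μ X) j z κ + linCovIter L U₀ (bump y μ X) j z κ) B (bump y μ X) ∧
      ‖dCov L U₀ B (bump y μ X) j z κ + linCovIter L U₀ (bump y μ X) j z κ‖ ≤
        ((1 + thetaCov d L α₀ * ((L : ℝ) ^ j * ((L : ℝ) ^ k)⁻¹) ^ 2) * (L : ℝ) ^ j + C3cov d L * ((L : ℝ) ^ j) ^ 2 * b)
          * (((L : ℝ) ^ j) ^ d)⁻¹ * ‖X‖ := by
  have hL1 : 1 ≤ L := le_trans (by norm_num) hL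
  have hL1r : (1 : ℝ) ≤ L := by exact_mod_cast hL1
  have hc₃' : 2 * ((L : ℝ) ^ k * b) ≤ c3 d L := by
    have : 0 ≤ (L : ℝ) ^ k * b := by positivity
    linarith
  have h131 : ∀ j < k, ∀ (x : Site d) (κ : Fin d), ‖logCovIter L U₀ B j x κ‖ ≤ 2 * ((L : ℝ) ^ j * b) :=
    fun j hj => (prop4_general_bounds L hL hG k U₀ hU₀ hα hα3 hα4 h52 B hb hB hsmall hc₃' j hj.le).2
  have hρ : ∀ j < k, 2 * ((L : ℝ) ^ j * b) < c3 d L / 4 := by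
    intro j hj
    have hjk : (L : ℝ) ^ j * b ≤ (L : ℝ) ^ k * b := mul_le_mul_of_nonneg_right (pow_le_pow_right₀ hL1r hj.le) hb
    linarith
  have hquot : 2 * C1ppCov d L / C3cov d L = 1 / 8 := by
    have := C1ppCov_pos d hL1
    rw [C3cov]; field_simp; ring
  have h155' : (2 * (L : ℝ) - 1) * (L : ℝ)⁻¹ ^ 2 + 2 * d * thetaCov d L α₀ * (L : ℝ)⁻¹ ^ 3
      + 2 * C1ppCov d L / C3cov d L
        * (1 + 2 * d * thetaCov d L α₀ * (L : ℝ)⁻¹ ^ 2 + 2 * d * C3cov d L * ((L : ℝ) ^ k * b)) * (L : ℝ)⁻¹ ^ 2 ≤ 1 := by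
    rw [hquot]; exact h155
  exact prop5_156 L hL U₀ k (thetaCov_nonneg d L hα.le) (C1ppCov_pos d hL1).le (C3cov_pos d hL1) hb
    (hadd_levels L hL hG k U₀ hU₀ hα hα3 hα4 h52) (hsmul_levels L hL hG k U₀ hU₀ hα hα3 hα4 h52)
    (h139_levels L hL hG k U₀ hU₀ hα hα3 hα4 h52) h145 (hloc_levels L hL k U₀)
    (h148_levels L hL hG k U₀ hU₀ hα hα3 hα4 h52) (hdiff_levels L hL hG k U₀ hU₀ hα hα3 hα4 h52) B h131 hρ h155' y μ X hj
    z κ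

end Regime

/-- **NON-VACUITY OF THE DISPLAYED SMALLNESS** («α₀, α₁ sufficiently small», p. 41): for `L ≥ 2`, the two conditions `h145` and
`h155` of `prop5_general_157` (with `t = Lᵏb`, resp. `‖A‖` in §4) FOLLOW from the simple pair `2dθ ≤ L³∕16` (a bound on `α₀`
through `θ = thetaCov d L α₀`) and `2d·C₃·t ≤ 1` (a bound on the field) — pure arithmetic in `L⁻¹ ≤ ½`.
[cite: Balaban1985Averaging, (155) p.41] -/
theorem smallness_sufficient {L d θ C₃ t : ℝ} (hL : 2 ≤ L) (hd : 0 ≤ d) (hθ : 0 ≤ θ)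
    (h1 : 2 * d * θ ≤ L ^ 3 / 16) (h2 : 2 * d * C₃ * t ≤ 1) :
    8 * d * θ * L⁻¹ ^ 4 ≤ 1 ∧
      (2 * L - 1) * L⁻¹ ^ 2 + 2 * d * θ * L⁻¹ ^ 3
        + 1 / 8 * (1 + 2 * d * θ * L⁻¹ ^ 2 + 2 * d * C₃ * t) * L⁻¹ ^ 2 ≤ 1 := by
  have hL0 : 0 < L := by linarith
  set l := L⁻¹ with hl_def
  have hl0 : 0 ≤ l := inv_nonneg.mpr hL0.le
  have hl : l ≤ 1 / 2 := by rw [hl_def, inv_eq_one_div, div_le_div_iff₀ hL0 (by norm_num)]; linarith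
  have hLl : L * l = 1 := mul_inv_cancel₀ hL0.ne'
  have hdθ : 0 ≤ 2 * d * θ := by positivity
  -- `2dθ·l³ ≤ 1/16` and `2dθ·l⁴ ≤ l/16`
  have hA : 2 * d * θ * l ^ 3 ≤ 1 / 16 := by
    calc 2 * d * θ * l ^ 3 ≤ L ^ 3 / 16 * l ^ 3 := mul_le_mul_of_nonneg_right h1 (by positivity)
      _ = (L * l) ^ 3 / 16 := by ring
      _ = 1 / 16 := by rw [hLl]; norm_num
  have hB : 2 * d * θ * l ^ 4 ≤ l / 16 := by
    calc 2 * d * θ * l ^ 4 ≤ L ^ 3 / 16 * l ^ 4 := mul_le_mul_of_nonneg_right h1 (by positivity)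
      _ = (L * l) ^ 3 * l / 16 := by ring
      _ = l / 16 := by rw [hLl]; ring
  refine ⟨?_, ?_⟩
  · calc 8 * d * θ * l ^ 4 = 4 * (2 * d * θ * l ^ 4) := by ring
      _ ≤ 4 * (l / 16) := by linarith [hB]
      _ ≤ 1 := by linarith
  · have hT1 : (2 * L - 1) * l ^ 2 ≤ 3 / 4 := by
      have e : (2 * L - 1) * l ^ 2 = 2 * (L * l) * l - l ^ 2 := by ring
      rw [e, hLl]
      nlinarith [mul_nonneg (sub_nonneg.2 hl) (by linarith : (0 : ℝ) ≤ 3 / 2 - l)]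
    have hl2 : l ^ 2 ≤ 1 / 4 := by nlinarith
    have hT3 : 1 / 8 * (1 + 2 * d * θ * l ^ 2 + 2 * d * C₃ * t) * l ^ 2 ≤ 1 / 8 * (1 / 2 + 1 / 32) := by
      have e : 1 / 8 * (1 + 2 * d * θ * l ^ 2 + 2 * d * C₃ * t) * l ^ 2
          = 1 / 8 * (l ^ 2 + 2 * d * θ * l ^ 4 + 2 * d * C₃ * t * l ^ 2) := by ring
      rw [e]
      have h3 : 2 * d * C₃ * t * l ^ 2 ≤ l ^ 2 := by
        have := mul_le_mul_of_nonneg_right h2 (sq_nonneg l); linarith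
      have h4 : l / 16 ≤ 1 / 32 := by linarith
      linarith
    linarith [hA, hT1, hT3]

/-! ## §4 (P5-d) The per-bond face for row S64's `landauCf` (END-II's Landau correction, `A`-currency) -/

section Landau

variable (L : ℕ) (hL : 2 ≤ L) {G : Subgroup 𝔸ˣ} (hG : AvgClosed d L G) (k : ℕ)
  (U₀ : Site d → Fin d → 𝔸ˣ) (hU₀ : ∀ x κ, U₀ x κ ∈ G) {α₀ : ℝ} (hα : 0 < α₀)
  (hα3 : C0 d * α₀ ≤ 1 / 3) (hα4 : 4 * α₀ ≤ c2' d L) (h52 : pdev U₀ < α₀ * (((L : ℝ) ^ k)⁻¹) ^ 2)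
  (S S' : Finset (Site d × Fin d))

omit [NormOneClass 𝔸] in
/-- `landauCf` (row S64) IS `C_k` of the scaled insertion, read on `S′`. [cite: Balaban1985Averaging, (134) p.38] -/
theorem landauCf_apply_eq_CCovIter (A : S → 𝔸) (c : S') :
    landauCf L U₀ k S S' A c = CCovIter L U₀ (scaleIns L k S A) k c.1.1 c.1.2 := rfl

omit [CompleteSpace 𝔸] [NormOneClass 𝔸] in
/-- the scaled insertion of the coordinate direction `Pi.single b X` is the single-bond variation `(L^{−k}X)·δ_b` — print's `ηδA`
with `δA = X·δ_b`. [cite: Balaban1985Averaging, (137)–(138) p.39] -/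
theorem scaleIns_single (b : S) (X : 𝔸) :
    scaleIns L k S (Pi.single b X) = bump b.1.1 b.1.2 ((((L : ℂ) ^ k)⁻¹) • X) := by
  funext x κ
  simp only [scaleIns, insCfg, bump]
  by_cases h : (x, κ) ∈ S
  · rw [dif_pos h, Pi.smul_apply, Pi.single_apply]
    by_cases hb : (⟨(x, κ), h⟩ : S) = b
    · have hx : x = b.1.1 ∧ κ = b.1.2 := by rw [← hb]; exact ⟨rfl, rfl⟩
      rw [if_pos hb, if_pos hx]
    · have hx : ¬ (x = b.1.1 ∧ κ = b.1.2) := fun hh => hb (Subtype.ext (Prod.ext hh.1 hh.2))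
      rw [if_neg hb, if_neg hx, smul_zero]
  · rw [dif_neg h]
    have hx : ¬ (x = b.1.1 ∧ κ = b.1.2) := fun hh => h (by rw [hh.1, hh.2]; exact b.2)
    rw [if_neg hx]

include hL hG hU₀ hα hα3 hα4 h52 in
/-- **(P5-d) PROPOSITION 5 (157) FOR END-II's LANDAU CORRECTION, PER BOND, k-UNIFORM**: for `b ∈ S`, `X ∈ 𝔸`, `c ∈ S′`, the map
`A′ ↦ landauCf(A′)(c)` has at `A` the directional derivative in the coordinate direction `Pi.single b X` (= `∂∕∂A_b` applied to `X`),
equal to `dC_k(ηA; (ηX)δ_b)(c)`, of norm `≤ C3cov(d,L)·‖A‖·L^{−kd}·‖X‖` — «|(δ∕δA_b)C_k(U₀, A, c)| ≦ C₃|A|» with the `η^d` of (138),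
UNIFORM IN `k`, under the displayed k-free smallness (`‖A‖` in place of `Lᵏb`); its LOCALITY half (`= 0` unless `b ⊂ Bᵏ(c₋) ∪
Bᵏ(c₊)`) is leaf-04-g5's `fderiv_landauCf_apply_single_eq_zero`.  This is leaf-08-g12's (72)-TYPE input «[4] Prop. 5».
[cite: Balaban1985Averaging, Prop. 5 (157) p.42, (138) p.39; Balaban1985Variational, (72) p.288] -/
theorem hasLineDerivAt_landauCf_single (A : S → 𝔸)
    (hsmall : Real.exp (4 * O1cov d * α₀) * (1 + 8 * C1cov d * ‖A‖) ≤ 2) (hc₃ : 8 * ‖A‖ < c3 d L)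
    (h145 : 8 * d * thetaCov d L α₀ * (L : ℝ)⁻¹ ^ 4 ≤ 1)
    (h155 : (2 * (L : ℝ) - 1) * (L : ℝ)⁻¹ ^ 2 + 2 * d * thetaCov d L α₀ * (L : ℝ)⁻¹ ^ 3
      + 1 / 8 * (1 + 2 * d * thetaCov d L α₀ * (L : ℝ)⁻¹ ^ 2 + 2 * d * C3cov d L * ‖A‖) * (L : ℝ)⁻¹ ^ 2 ≤ 1)
    (b : S) (X : 𝔸) (c : S') :
    HasLineDerivAt ℂ (fun A' => landauCf L U₀ k S S' A' c)
        (dCov L U₀ (scaleIns L k S A) (bump b.1.1 b.1.2 ((((L : ℂ) ^ k)⁻¹) • X)) k c.1.1 c.1.2) A (Pi.single b X) ∧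
      ‖dCov L U₀ (scaleIns L k S A) (bump b.1.1 b.1.2 ((((L : ℂ) ^ k)⁻¹) • X)) k c.1.1 c.1.2‖ ≤
        C3cov d L * ‖A‖ * (((L : ℝ) ^ k) ^ d)⁻¹ * ‖X‖ := by
  have hL1 : 1 ≤ L := le_trans (by norm_num) hL
  have hLη : (L : ℝ) ^ k * (((L : ℝ) ^ k)⁻¹ * ‖A‖) = ‖A‖ := pow_mul_inv_mul hL1 k ‖A‖
  have hB : ∀ x κ, ‖scaleIns L k S A x κ‖ ≤ ((L : ℝ) ^ k)⁻¹ * ‖A‖ := norm_scaleIns_le L k S A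
  obtain ⟨h1, h2, -⟩ := prop5_general_157 L hL hG k U₀ hU₀ hα hα3 hα4 h52 (scaleIns L k S A) (by positivity) hB
    (by rw [hLη]; exact hsmall) (by rw [hLη]; exact hc₃) h145 (by rw [hLη]; exact h155) b.1.1 b.1.2
    ((((L : ℂ) ^ k)⁻¹) • X) le_rfl c.1.1 c.1.2
  set v : ↥S → 𝔸 := Pi.single b X with hv
  refine ⟨?_, h2.trans (le_of_eq ?_)⟩
  · have h1' : HasDerivAt (fun t : ℂ =>
        CCovIter L U₀ (scaleIns L k S A + t • bump b.1.1 b.1.2 ((((L : ℂ) ^ k)⁻¹) • X)) k c.1.1 c.1.2) _ 0 := h1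
    show HasDerivAt (fun t : ℂ => landauCf L U₀ k S S' (A + t • v) c) _ 0
    refine h1'.congr_of_eventuallyEq (Filter.Eventually.of_forall fun t => ?_)
    simp only [hv, landauCf_apply_eq_CCovIter, scaleIns_add, scaleIns_smul, scaleIns_single]
  · rw [norm_smul, norm_inv, norm_pow, Complex.norm_natCast]
    have hLk : ((L : ℝ) ^ k) * ((L : ℝ) ^ k)⁻¹ = 1 := mul_inv_cancel₀ (by positivity)
    calc C3cov d L * ((L : ℝ) ^ k) ^ 2 * (((L : ℝ) ^ k) ^ d)⁻¹ * (((L : ℝ) ^ k)⁻¹ * ‖A‖) * (((L : ℝ) ^ k)⁻¹ * ‖X‖)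
        = C3cov d L * ‖A‖ * (((L : ℝ) ^ k) ^ d)⁻¹ * ‖X‖ * (((L : ℝ) ^ k) * ((L : ℝ) ^ k)⁻¹) ^ 2 := by ring
      _ = C3cov d L * ‖A‖ * (((L : ℝ) ^ k) ^ d)⁻¹ * ‖X‖ := by rw [hLk, one_pow, mul_one]

include hL hG hU₀ hα hα3 hα4 h52 in
/-- … hence, where `landauCf` is differentiable (row S64's `landauCorrection_binders` on the ball of radius `landauRad`), the
Fréchet derivative `𝒞 := fderiv ℂ landauCf A` satisfies `‖𝒞(Pi.single b X)(c)‖ ≤ C3cov·‖A‖·L^{−kd}·‖X‖` — the majorant of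
leaf-08-g12's (72)∕(73) input, k-UNIFORM. [cite: Balaban1985Averaging, Prop. 5 (157) p.42; Balaban1985Variational, (72) p.288] -/
theorem fderiv_landauCf_single (A : S → 𝔸) (hd : DifferentiableAt ℂ (landauCf L U₀ k S S') A)
    (hsmall : Real.exp (4 * O1cov d * α₀) * (1 + 8 * C1cov d * ‖A‖) ≤ 2) (hc₃ : 8 * ‖A‖ < c3 d L)
    (h145 : 8 * d * thetaCov d L α₀ * (L : ℝ)⁻¹ ^ 4 ≤ 1)
    (h155 : (2 * (L : ℝ) - 1) * (L : ℝ)⁻¹ ^ 2 + 2 * d * thetaCov d L α₀ * (L : ℝ)⁻¹ ^ 3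
      + 1 / 8 * (1 + 2 * d * thetaCov d L α₀ * (L : ℝ)⁻¹ ^ 2 + 2 * d * C3cov d L * ‖A‖) * (L : ℝ)⁻¹ ^ 2 ≤ 1)
    (b : S) (X : 𝔸) (c : S') :
    fderiv ℂ (landauCf L U₀ k S S') A (Pi.single b X) c =
        dCov L U₀ (scaleIns L k S A) (bump b.1.1 b.1.2 ((((L : ℂ) ^ k)⁻¹) • X)) k c.1.1 c.1.2 ∧
      ‖fderiv ℂ (landauCf L U₀ k S S') A (Pi.single b X) c‖ ≤ C3cov d L * ‖A‖ * (((L : ℝ) ^ k) ^ d)⁻¹ * ‖X‖ := by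
  obtain ⟨h1, h2⟩ := hasLineDerivAt_landauCf_single L hL hG k U₀ hU₀ hα hα3 hα4 h52 S S' A hsmall hc₃ h145 h155 b X c
  set v : ↥S → 𝔸 := Pi.single b X with hv
  have hF : HasDerivAt (fun t : ℂ => landauCf L U₀ k S S' (A + t • v))
      (fderiv ℂ (landauCf L U₀ k S S') A v) 0 := hd.hasFDerivAt.hasLineDerivAt v
  have hFc : HasDerivAt (fun t : ℂ => landauCf L U₀ k S S' (A + t • v) c)
      (fderiv ℂ (landauCf L U₀ k S S') A v c) 0 :=
    ((ContinuousLinearMap.proj (R := ℂ) (φ := fun _ : ↥S' => 𝔸) c).hasFDerivAt).comp_hasDerivAt (0 : ℂ) hF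
  have h1' : HasDerivAt (fun t : ℂ => landauCf L U₀ k S S' (A + t • v) c)
      (dCov L U₀ (scaleIns L k S A) (bump b.1.1 b.1.2 ((((L : ℂ) ^ k)⁻¹) • X)) k c.1.1 c.1.2) 0 := h1
  have heq := hFc.unique h1'
  exact ⟨heq, heq ▸ h2⟩

open Classical in
include hL hG hU₀ hα hα3 hα4 h52 in
/-- **(P5-d) THE (72)-BINDER OF ROW S67, INHABITED**: in leaf-08-g12's shape `hγ : ∀ b′ a c, ‖𝒞 (Pi.single b′ a) c‖ ≤ γ c b′·‖a‖`
(`ShellMeasureLandauDerivativeDecay.landauDerivative_decay_of_majorants`) with `𝒞 = fderiv ℂ landauCf A` and the LOCAL majorant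
`γ c b := 𝟙[b ⊂ Bᵏ(c₋) ∪ Bᵏ(c₊)]·C3cov·‖A‖·L^{−kd}` — the bound half is `fderiv_landauCf_single`, the locality half leaf-04-g5's
`fderiv_landauCf_apply_single_eq_zero`; k-UNIFORM. [cite: Balaban1985Averaging, Prop. 5 (157) p.42; Balaban1985Variational, (72)–(73) p.288] -/
theorem norm_fderiv_landauCf_single_le_local (A : S → 𝔸) (hd : DifferentiableAt ℂ (landauCf L U₀ k S S') A)
    (hsmall : Real.exp (4 * O1cov d * α₀) * (1 + 8 * C1cov d * ‖A‖) ≤ 2) (hc₃ : 8 * ‖A‖ < c3 d L)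
    (h145 : 8 * d * thetaCov d L α₀ * (L : ℝ)⁻¹ ^ 4 ≤ 1)
    (h155 : (2 * (L : ℝ) - 1) * (L : ℝ)⁻¹ ^ 2 + 2 * d * thetaCov d L α₀ * (L : ℝ)⁻¹ ^ 3
      + 1 / 8 * (1 + 2 * d * thetaCov d L α₀ * (L : ℝ)⁻¹ ^ 2 + 2 * d * C3cov d L * ‖A‖) * (L : ℝ)⁻¹ ^ 2 ≤ 1)
    (b : S) (X : 𝔸) (c : S') :
    ‖fderiv ℂ (landauCf L U₀ k S S') A (Pi.single b X) c‖ ≤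
      (if BondIn (loK L k c.1.1) (bondHiK L k c.1.1 c.1.2) b.1.1 b.1.2 then C3cov d L * ‖A‖ * (((L : ℝ) ^ k) ^ d)⁻¹ else 0)
        * ‖X‖ := by
  split_ifs with hb
  · exact (fderiv_landauCf_single L hL hG k U₀ hU₀ hα hα3 hα4 h52 S S' A hd hsmall hc₃ h145 h155 b X c).2
  · rw [fderiv_landauCf_apply_single_eq_zero (le_trans (by norm_num) hL) U₀ k S S' hd c b hb X, norm_zero, zero_mul]

open Classical in
include hL hG hU₀ hα hα3 hα4 h52 in
/-- **(157) IN THE PAIRING FORM (138)∕(149) FOR A GENERAL VARIATION** «|⟨(δ∕δA)C_k(U₀, A), δA⟩| ≦ C₃|A|Q″_k|δA|»: by linearity of the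
Fréchet derivative the per-bond columns sum, and for every `δA ∈ 𝔸^S` and every `c ∈ S′`
`‖D(landauCf)(A)(δA)(c)‖ ≤ C3cov·‖A‖·Σ_{b ⊂ Bᵏ(c₋)∪Bᵏ(c₊)} L^{−kd}‖δA_b‖` — the right side IS `C₃|A|·(Q″_k|δA|)(c)` of (141)∕(149)
with `η^d = L^{−kd}` (v1.1, additive: closes the «per bond only» divergence of v1 for the A-currency object).
[cite: Balaban1985Averaging, (138) p.39, (141) p.39, (149) p.40, Prop. 5 (157) p.42] -/
theorem norm_fderiv_landauCf_le_Qpp (A : S → 𝔸) (hd : DifferentiableAt ℂ (landauCf L U₀ k S S') A)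
    (hsmall : Real.exp (4 * O1cov d * α₀) * (1 + 8 * C1cov d * ‖A‖) ≤ 2) (hc₃ : 8 * ‖A‖ < c3 d L)
    (h145 : 8 * d * thetaCov d L α₀ * (L : ℝ)⁻¹ ^ 4 ≤ 1)
    (h155 : (2 * (L : ℝ) - 1) * (L : ℝ)⁻¹ ^ 2 + 2 * d * thetaCov d L α₀ * (L : ℝ)⁻¹ ^ 3
      + 1 / 8 * (1 + 2 * d * thetaCov d L α₀ * (L : ℝ)⁻¹ ^ 2 + 2 * d * C3cov d L * ‖A‖) * (L : ℝ)⁻¹ ^ 2 ≤ 1)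
    (δ : S → 𝔸) (c : S') :
    ‖fderiv ℂ (landauCf L U₀ k S S') A δ c‖ ≤
      C3cov d L * ‖A‖ * ∑ b : S,
        (if BondIn (loK L k c.1.1) (bondHiK L k c.1.1 c.1.2) b.1.1 b.1.2 then (((L : ℝ) ^ k) ^ d)⁻¹ else 0) * ‖δ b‖ := by
  have hsplit : fderiv ℂ (landauCf L U₀ k S S') A δ = ∑ b : S, fderiv ℂ (landauCf L U₀ k S S') A (Pi.single b (δ b)) := by
    conv_lhs => rw [← Finset.univ_sum_single δ]
    rw [map_sum]
  rw [hsplit, Finset.sum_apply, Finset.mul_sum]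
  refine (norm_sum_le _ _).trans (Finset.sum_le_sum fun b _ => ?_)
  have h := norm_fderiv_landauCf_single_le_local L hL hG k U₀ hU₀ hα hα3 hα4 h52 S S' A hd hsmall hc₃ h145 h155 b (δ b) c
  refine h.trans (le_of_eq ?_)
  split_ifs <;> ring

end Landau

end Summit.QuantumFields.BalabanUV.T4Continuum.ShellMeasureAverageProp5General

end
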